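import Mathlib.NumberTheory.NumberField.InfinitePlace.TotallyRealComplex
import Literature.IUT.HodgeTheaters.InitialThetaData
import HarnessLib

/-!
# [IUTchI] Definition 3.1 (a) ⇒ every archimedean place of `F` and of `K` is COMPLEX (`K_v ≅ ℂ` for `v ∈ V^arc`)

S. Mochizuki, *Inter-universal Teichmüller theory I*, §3, Definition 3.1 (a), kurims text (May 2020) p. 61:
"`F` is a number field such that `√−1 ∈ F`" [cite: Mochizuki2012, Def 3.1 (a) p.61]; Example 3.4 (i), p. 80:
"for `□ ∈ {…}`, we have a complex archimedean topological field [i.e., a "CAF"] `A_□`" and "`C_v` … the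
archimedean Frobenioid … where we take the base category … to be the one-morphism category determined by
`Spec(K_v)`" [cite: Mochizuki2012, Ex 3.4 (i) p.80].

WHY THIS FILE (abc-iut cell, home node IUTchI:Ex3.4(i); seat abc-iut-w4-d074).  The cell models the archimedean
local data at `v ∈ V̲^arc` over `K_v = ℂ` (`ArchLocalFrobenioid ℂ`, `LocalFrobenioidsArch(Model).lean`;
`ArchFrd.ptBase := Spec ℂ`, `ArchimedeanPointBase.lean`).  That every archimedean completion IS `ℂ` — i.e. that
`F` and `K ⊇ F` have NO real place — is the elementary consequence of Def. 3.1 (a) proved here (classical: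
a real embedding would send `√−1` to a real square root of `−1`): `infinitePlace_isComplex_of_sq_eq_neg_one`,
`isTotallyComplex_of_sq_eq_neg_one` (any field with `i² = −1`), and for initial Θ-data
`InitialThetaData.isTotallyComplex_F`, `InitialThetaData.isTotallyComplex_K`,
`InitialThetaData.infinitePlace_isComplex` (every `w ∈ V(K)^arc` is complex, so `K_w ≅ ℂ`).  Proof-only; nothing
of the series' disputed content is involved; no side is taken on [IUTchIII] Cor. 3.12.
-/

namespace Literature.IUT.HodgeTheaters

open NumberField

universe u v w

/-- A field containing a square root of `−1` has no real embedding: every infinite place is complex.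
[cite: Mochizuki2012, Def 3.1 (a) p.61] -/
theorem infinitePlace_isComplex_of_sq_eq_neg_one {L : Type u} [Field L] {i : L} (hi : i ^ 2 = -1)
    (w : InfinitePlace L) : w.IsComplex := by
  rw [← InfinitePlace.not_isReal_iff_isComplex]
  intro hw
  have h : ((InfinitePlace.embedding_of_isReal hw i : ℝ) : ℂ) ^ 2 = -1 := by
    rw [InfinitePlace.embedding_of_isReal_apply, ← map_pow, hi, map_neg, map_one]
  have h' : (InfinitePlace.embedding_of_isReal hw i : ℝ) ^ 2 = -1 := by exact_mod_cast h
  nlinarith [sq_nonneg (InfinitePlace.embedding_of_isReal hw i)]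

/-- A number field containing a square root of `−1` is totally complex. [cite: Mochizuki2012, Def 3.1 (a) p.61] -/
theorem isTotallyComplex_of_sq_eq_neg_one {L : Type u} [Field L] {i : L} (hi : i ^ 2 = -1) :
    IsTotallyComplex L :=
  ⟨infinitePlace_isComplex_of_sq_eq_neg_one hi⟩

namespace InitialThetaData

variable {F : Type u} {K : Type v} {Fbar : Type w} [Field F] [NumberField F] [Field K] [NumberField K]
  [Algebra F K] [Field Fbar] [Algebra F Fbar] [Algebra K Fbar] {E : WeierstrassCurve F} [E.IsElliptic] {l : ℕ}
  {P : BadPlacePredicates K}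

/-- **Def. 3.1 (a) ⇒ `F` is totally complex** ("`√−1 ∈ F`": no real place). [cite: Mochizuki2012, Def 3.1 (a) p.61] -/
theorem isTotallyComplex_F (D : InitialThetaData F K Fbar E l P) : IsTotallyComplex F := by
  obtain ⟨i, hi⟩ := D.sqrt_neg_one_mem
  exact isTotallyComplex_of_sq_eq_neg_one hi

/-- **Def. 3.1 (a), (c) ⇒ `K ⊇ F` is totally complex** (`√−1 ∈ F ⊆ K`). [cite: Mochizuki2012, Def 3.1 (a) p.61] -/
theorem isTotallyComplex_K (D : InitialThetaData F K Fbar E l P) : IsTotallyComplex K := by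
  obtain ⟨i, hi⟩ := D.sqrt_neg_one_mem
  refine isTotallyComplex_of_sq_eq_neg_one (i := algebraMap F K i) ?_
  rw [← map_pow, hi, map_neg, map_one]

/-- **Every archimedean valuation `w ∈ V(K)^arc` is complex** — so `K_w ≅ ℂ`, the "complex archimedean field"
of Example 3.4 (i), and the base of `C_w` is the one-morphism category at `Spec ℂ`.
[cite: Mochizuki2012, Ex 3.4 (i) p.80] -/
theorem infinitePlace_isComplex (D : InitialThetaData F K Fbar E l P) (w : InfinitePlace K) : w.IsComplex :=
  D.isTotallyComplex_K.isComplex w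

/-- The same for `F`: every `v ∈ V(F)^arc` is complex. [cite: Mochizuki2012, Def 3.1 (a) p.61] -/
theorem infinitePlace_isComplex_F (D : InitialThetaData F K Fbar E l P) (v : InfinitePlace F) :
    v.IsComplex :=
  D.isTotallyComplex_F.isComplex v

end InitialThetaData

end Literature.IUT.HodgeTheaters
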